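/-
Origin: expansion seat `planner-pub-hodgecm-pv11-0`, handover 2026-08-18 (`HOME/pub-hodgecm-pv11/lean/Pv11/SeesawDictionary.lean`, md5 f942ea4b, 157 lines);
landed by the gen-6 packager in gate run 22 as `HodgeCM/PerL34/SeesawDictionary.lean` (verbatim).
-/
import Summits.HodgeConjecture.HodgeCM.PerL34.SeesawWedge
import Summits.HodgeConjecture.HodgeCM.PerL34.OpenInputsN19

/-!
# Seam S5 (`N19w_genIdentity` half): the model-level seesaw-generator identity from the KERNEL seesaw
# identity of the lattice shell, modulo a named D4/D5 DICTIONARY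

LEMMAS.md v4 §9, seam **S5** (carver gen 2, 04:07Z): "`N19w_genIdentity` (T.Λ Γ ω ω′ = D.ϑ χ Φ — the seesaw
identity (eq:seesaw) on generators, N17) ← pv11 `Seesaw.thetaKernel_tmul` / `eq_seesaw` over the lattice-sum
shell D4′ … BRIDGE missing: `T.SK V c` / `D.ϑ` / `T.Λ` := the lattice model's Schwartz space, torus period and
cup pairing (D4) and the (1,0)-part ↔ Fock dictionary (D5)."  This file TYPES that bridge as a record
`SeesawBridge T V c D k l` (a lattice shell `ThetaSeesawData` + its N17 hypotheses + the dictionary fields, each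
labelled below) and PROVES

* `N19w_genIdentity_of_bridge : SeesawBridge T V c D k l → N19w_genIdentity T V c D k l`
  (the posited model-level leaf of `S12Wedges` :144 becomes KERNEL modulo the dictionary), and
* `open_thetaGen12_of_bridges` : a bridge at every good context + `Open_chars` (node N31) ⇒
  `T.Open_thetaGen12` (= pv08's `open_thetaGen12_of_genIdentity` with `hgen` DISCHARGED).

PerL v5, proof of Lemma 3.5, tex ll. 372–375 (verbatim): "`u_1\wedge u_2=\vartheta_{T,\chi_{12}}(\Phi')=
\mathrm{pr}_\kappa\vartheta_{T,\chi_{12}}(\Phi')=\vartheta_{T,\chi_{12}}(\mathrm{pr}_\kappa\Phi')` for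
`\Phi'=\phi^1_1\otimes\phi^2_2-\phi^2_1\otimes\phi^1_2`, since `u_1\wedge u_2` is of pure type `\kappa` and
`\mathrm{pr}_\kappa` commutes with `\vartheta_{T,\chi_{12}}`."  Factorisation typed here:

  `T.Λ Γ ω ω′`  =(field `Λ_wedge`, D5)=  `toHG (u₁¹u₂² − u₁²u₂¹)`,  `u^i_j = θ(φ^i_j, χ′_j)` shell theta lifts
               =(KERNEL `SeesawWedge.genIdentity_core`, node N17 = (eq:seesaw) twice + additivity)=
                 `toHG (ϑ_{T,χ₁₂}(Φ′))`,  `Φ′ = φ¹₁⊗φ²₂ − φ²₁⊗φ¹₂` (shell torus period)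
               =(field `ϑ_period`, D5 `pr_κ` step + D4 definition of the model's `ϑ`, `X`, `𝒮^κ`)=  `D.ϑ χ Φ`.

## Labels of the bridge fields (G-R2-14 vocabulary; nothing here is a cited fact)

* SETUP/DATA (D4′): `DS : ThetaSeesawData` (the lattice shell of the LANDED `Seesaw.lean`), its vector-space
  structure on `𝒮((V₃⊗W)(𝔸))`, measurable structures and the Haar probability measures `ν₁, ν₂` of
  `[U(W₁)]`, `[U(W₂)]`; `toHG : (G_U(𝔸) → ℂ) → L²([G_U])` (D5: the class of an automorphic function; junk
  elsewhere); `Adm₁/Adm₂` (D1/D5: "(χ′_j, φ) with χ′_j the character of an allowed pair of type Ψ and φ a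
  `κ_j`-typed Schwartz function" — an opaque predicate of the dictionary).
* N17 HYPOTHESES (exactly those of the landed `genIdentity_core`; labelled there): `omegaSub`, `evSub`
  (STRUCTURAL: ω_{W,μ_W}(g,t) and evaluation are additive), `evalTmul`, `restrictTmul` (DEFINITIONAL / PRINT
  [HKS96 (1.13)–(1.16) p. 952, Cor. A.3 p. 998; Ku94 §1]), `absSummable₁/₂` (PRINT-trivial: Schwartz–Bruhat
  sums), `integrable₁/₂` (PerL l. 335: integrals over the compact `[U(W_j)]` of continuous functions).
* DICTIONARY (the seam itself, INTERNAL-DEFINITIONAL, not provable in the package — LEMMAS §3 D4/D5):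
  `Λ_wedge` = (i) `T.Theta V c k Γ` consists of theta one-forms `u_f` (PerL §3.2 ll. 258–268), (ii) the two
  frame components of `u_f` are the theta lifts `θ(φ¹,χ′), θ(φ²,χ′)` of admissible shell data, (iii)
  `T.emb Γ (u₁ ∪ u₂)` is the function `u₁¹u₂² − u₁²u₂¹` (Matsushima dictionary (Qaut), ll. 238–257);
  `ϑ_period` = (iv) `ϑ_{T,χ₁₂}(Φ′) = ϑ_{T,χ₁₂}(pr_κ Φ′)` (l. 374–375, `K_∞`-types, D5) and (v) `D.ϑ χ Φ :=
  inclCG (ϑ_{T,χ}(Φ))` for `χ = χ′₁ ⊠ χ′₂ ∈ D.X`, `Φ = pr_κ Φ′ ∈ 𝒮^κ` (D4: definition of the model's torus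
  side).  These two fields are WEAKER than `N19w_genIdentity` separately (neither mentions both `T.Λ` and
  `D.ϑ`); the kernel seesaw identity is what joins them.

Unit `pub-hodgecm-pv11` (DAG-node prover #11), 2026-08-18.  Fully kernel-checked; no new axioms.
-/

set_option autoImplicit false

noncomputable section

open MeasureTheory
open HodgeCM.Prior.Perl34File
open HodgeCM.PerL34.Seesaw

namespace HodgeCM
namespace PerL34
namespace SeesawDictionary

variable {U : Universe} (T : U.ThetaModel)
variable {L : CMField} {ι₁ : L →+* ℂ} (V : HermSpace3 L ι₁) (c : SeesawCtx L)
variable (D : Perl34.TorusData (T.core V c)) (k l : Fin 4)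

/-- **The S5 bridge record** for the side `(k,l)` with torus data `D`: a lattice shell with its N17 hypotheses
and the D4/D5 dictionary to the model (see the module docstring for the label of every field). -/
structure SeesawBridge where
  /-- SETUP (D4′): the lattice shell `(G_U(𝔸), U(W_j)(𝔸), (V₃⊗W_j)(L₀), 𝒮, ω, ev, ⊗)` of `Seesaw.lean` -/
  DS : ThetaSeesawData
  /-- `𝒮((V₃⊗W)(𝔸))` is a vector space (used through differences only) -/
  [instS : AddCommGroup DS.S]
  [instA₁ : MeasurableSpace DS.A₁]
  [instA₂ : MeasurableSpace DS.A₂]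
  /-- Haar probability measures of `[U(W₁)]`, `[U(W₂)]` -/
  ν₁ : Measure DS.A₁
  ν₂ : Measure DS.A₂
  [sf₁ : SFinite ν₁]
  [sf₂ : SFinite ν₂]
  /-- N17 hypotheses (as in the landed `SeesawWedge.genIdentity_core`) -/
  omegaSub : DS.OmegaSub
  evSub : DS.EvSub
  evalTmul : DS.EvalTmul
  restrictTmul : DS.RestrictTmul
  absSummable₁ : DS.AbsSummable₁
  absSummable₂ : DS.AbsSummable₂
  /-- D5: realisation of a function on `G_U(𝔸)` as an element of `L²([G_U])` -/
  toHG : (DS.G → ℂ) → T.HG L ι₁ V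
  /-- D1/D5: admissible shell data `(χ′₁, φ)` of type `k` on `W₁`, resp. `(χ′₂, φ)` of type `l` on `W₂` -/
  Adm₁ : (DS.A₁ → ℂ) → DS.S₁ → Prop
  Adm₂ : (DS.A₂ → ℂ) → DS.S₂ → Prop
  /-- PerL l. 335: `u ↦ θ_φ(g,u)χ′(u)` is integrable on the compact `[U(W_j)]` -/
  integrable₁ : ∀ (χ₁ : DS.A₁ → ℂ) (φ : DS.S₁), Adm₁ χ₁ φ → ∀ g : DS.G,
    Integrable (fun u => DS.thetaKernel₁ φ g u * χ₁ u) ν₁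
  integrable₂ : ∀ (χ₂ : DS.A₂ → ℂ) (φ : DS.S₂), Adm₂ χ₂ φ → ∀ g : DS.G,
    Integrable (fun u => DS.thetaKernel₂ φ g u * χ₂ u) ν₂
  /-- DICTIONARY D5 (Λ side): theta one-forms of types `k`, `l` have admissible theta-lift components
  `u^i_j = θ(φ^i_j, χ′_j)` and `T.Λ Γ u₁ u₂ = toHG (u₁¹u₂² − u₁²u₂¹)` -/
  Λ_wedge : ∀ (Γ : Level V), ∀ ω ∈ T.Theta V c k Γ, ∀ ω' ∈ T.Theta V c l Γ,
    ∃ (χ₁ : DS.A₁ → ℂ) (χ₂ : DS.A₂ → ℂ) (φ₁₁ φ₁₂ : DS.S₁) (φ₂₁ φ₂₂ : DS.S₂),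
      Adm₁ χ₁ φ₁₁ ∧ Adm₁ χ₁ φ₁₂ ∧ Adm₂ χ₂ φ₂₁ ∧ Adm₂ χ₂ φ₂₂ ∧
      T.Λ Γ ω ω' = toHG (DS.wedgeScalar (DS.thetaLift₁ ν₁ χ₁ φ₁₁) (DS.thetaLift₁ ν₁ χ₁ φ₁₂)
        (DS.thetaLift₂ ν₂ χ₂ φ₂₁) (DS.thetaLift₂ ν₂ χ₂ φ₂₂))
  /-- DICTIONARY D5 (`pr_κ`) + D4 (`ϑ`): for admissible data the torus period of
  `Φ′ = φ₁₁⊗φ₂₂ − φ₁₂⊗φ₂₁` is a model generator `D.ϑ χ Φ` (`χ = χ′₁ ⊠ χ′₂`, `Φ = pr_κ Φ′`) -/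
  ϑ_period : ∀ (χ₁ : DS.A₁ → ℂ) (χ₂ : DS.A₂ → ℂ) (φ₁₁ φ₁₂ : DS.S₁) (φ₂₁ φ₂₂ : DS.S₂),
    Adm₁ χ₁ φ₁₁ → Adm₁ χ₁ φ₁₂ → Adm₂ χ₂ φ₂₁ → Adm₂ χ₂ φ₂₂ →
      ∃ χ : D.X, ∃ Φ, D.ϑ χ Φ =
        toHG (DS.thetaPeriod ν₁ ν₂ χ₁ χ₂ (DS.tmul φ₁₁ φ₂₂ - DS.tmul φ₁₂ φ₂₁))

attribute [instance] SeesawBridge.instS SeesawBridge.instA₁ SeesawBridge.instA₂ SeesawBridge.sf₁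
  SeesawBridge.sf₂

variable {T V c D k l}

/-- **Seam S5, `N19w` half (KERNEL modulo the dictionary):** the model-level seesaw-generator identity
`S12Wedges.N19w_genIdentity` follows from a bridge record, the join being the LANDED kernel identity
`SeesawWedge.genIdentity_core` (node N17). -/
theorem N19w_genIdentity_of_bridge (B : SeesawBridge T V c D k l) : N19w_genIdentity T V c D k l := by
  intro Γ ω hω ω' hω'
  obtain ⟨χ₁, χ₂, φ₁₁, φ₁₂, φ₂₁, φ₂₂, h₁₁, h₁₂, h₂₁, h₂₂, hΛ⟩ := B.Λ_wedge Γ ω hω ω' hω'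
  obtain ⟨χ, Φ, hϑ⟩ := B.ϑ_period χ₁ χ₂ φ₁₁ φ₁₂ φ₂₁ φ₂₂ h₁₁ h₁₂ h₂₁ h₂₂
  refine ⟨χ, Φ, ?_⟩
  rw [hΛ, hϑ]
  congr 1
  funext g
  exact B.DS.genIdentity_core B.ν₁ B.ν₂ B.omegaSub B.evSub B.evalTmul B.restrictTmul B.absSummable₁
    B.absSummable₂ χ₁ χ₂ φ₁₁ φ₁₂ φ₂₁ φ₂₂ g (B.integrable₁ χ₁ φ₁₁ h₁₁ g) (B.integrable₁ χ₁ φ₁₂ h₁₂ g)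
    (B.integrable₂ χ₂ φ₂₁ h₂₁ g) (B.integrable₂ χ₂ φ₂₂ h₂₂ g)

/-- With allowedness of the characters (node N31, `N19_charsIn`): the ALLOWED form of the identity. -/
theorem N19w_genIdentityAllowed_of_bridge (B : SeesawBridge T V c D k l) (hch : N19_charsIn T V c D) :
    N19w_genIdentityAllowed T V c D k l :=
  N19w_genIdentityAllowed_of T V c D k l (N19w_genIdentity_of_bridge B) hch

/-- The (wedge ⊆ S) inclusion of Lemma 3.5 for the side, from a bridge and allowedness. -/
theorem N19_wedgeIn_of_bridge (B : SeesawBridge T V c D k l) (hch : N19_charsIn T V c D) :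
    N19_wedgeIn T V c D k l :=
  N19w_of T V c D k l (N19w_genIdentity_of_bridge B) hch

variable (T) in
/-- **pv08's adapter with `hgen` DISCHARGED:** a bridge at every good context for the (12) side plus
`Open_chars` (node N31) gives the realisation input `Open_thetaGen12`. -/
theorem open_thetaGen12_of_bridges
    (hB : ∀ {L : CMField} {ι₁ : L →+* ℂ} (V : HermSpace3 L ι₁) (c : SeesawCtx L), T.GoodCtx ι₁ c →
      Nonempty (SeesawBridge T V c (T.t12 V c) 0 1))
    (hch : T.Open_chars) : T.Open_thetaGen12 :=
  open_thetaGen12_of_genIdentity T (fun V c hc => (hB V c hc).elim fun B => N19w_genIdentity_of_bridge B) hch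

end SeesawDictionary
end PerL34
end HodgeCM

end
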